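import Mathlib
import HarnessLib

/-!
# Trilinear forms with Kloosterman fractions: expanding the diagonal (Bettin–Chandee §3, first display)

Topic `NumberTheory/LFunctions`.  S. Bettin, V. Chandee, *Trilinear forms with Kloosterman
fractions*, Adv. Math. 328 (2018), §3, first display: the diagonal part of the amplified second
moment is
"`𝒟_b = ∑_{m∈𝓜} ∑∑_{ℓ₁n₁=ℓ₂n₂} β_{n₁} β̄_{n₂} ∑_{a₁,a₂} ν_{a₁} ν̄_{a₂} e(ϑa₁ m̄/(bn₁) − ϑa₂ m̄/(bn₂))
 ≪ ∑_{n₁} |β_{n₁}ν_{a₁}|² ∑_{ℓ₁,ℓ₂,ℓ₂∣ℓ₁n₁} ∑_{a₂} |∑_m e(ϑ(a₁ℓ₁ − a₂ℓ₂)m̄/(bℓ₁n₁))|`".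
This file PROVES the purely algebraic first half of this display for the general-`A`, twisted
diagonal `∑_m Diag_m(c)` of `TrilinearKloostermanFractionsFrom51.lean` (hypothesis `hD`): the sum
over `m` is moved inside, the coefficients `c_m(n) = γ_n ∑_a ν_a e(⋯)` are expanded, and norms are
taken:

* `BC_diag_expand` — `∑_m Diag_m(c) = ∑_{ℓ₁,n₁,a₁} ∑_{ℓ₂,n₂,a₂} [ℓ₁n₁ = ℓ₂n₂] (γ_{n₁}ν_{a₁}) conj(γ_{n₂}ν_{a₂}) S`,
  `S = ∑_{m, (m,b)=1, (ℓ₂n₂,m)=1} e(⋯a₁⋯n₁⋯) conj e(⋯a₂⋯n₂⋯)` (the `m`-sum of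
  `TrilinearKloostermanFractionsDiagTerm.lean`);
* `BC_diag_norm_le` — `‖∑_m Diag_m(c)‖ ≤ ∑ ⋯ [ℓ₁n₁ = ℓ₂n₂] ‖γ_{n₁}‖‖ν_{a₁}‖ ‖γ_{n₂}‖‖ν_{a₂}‖ ‖S‖`.

No new named facts (D-0026).

## References

* S. Bettin, V. Chandee, Adv. Math. 328 (2018) 1234–1262 (arXiv:1502.00769), §3 (first display).
  [BettinChandee2018]
-/

noncomputable section

open Finset Real

namespace Literature.NumberTheory.LFunctions

/-- **Expanding the diagonal** (Bettin–Chandee §3, first display, equality part): the sum over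
`m` moved inside, `c_m(n₁) conj c_m(n₂)` expanded into the double sum over `a₁, a₂`; on the diagonal
`ℓ₁n₁ = ℓ₂n₂` the congruence condition of the amplified form is automatic.
[cite: BettinChandee2018, §3] -/
theorem BC_diag_expand (b : ℕ) (M N' A : ℝ) (ϑ : ℤ) (η : ℝ) (γ ν : ℕ → ℂ) (L : ℕ) :
    ∑ m ∈ (Ioc ⌊M⌋₊ ⌊2 * M⌋₊).filter (fun m => m.Coprime b), ∑ ℓ₁ ∈ ((Ioc L (2 * L)).filter (fun ℓ => ℓ.Prime ∧ ℓ.Coprime b ∧ ℓ.Coprime ϑ.natAbs)), ∑ n₁ ∈ Icc 1 ⌊2 * N'⌋₊,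
          ∑ ℓ₂ ∈ ((Ioc L (2 * L)).filter (fun ℓ => ℓ.Prime ∧ ℓ.Coprime b ∧ ℓ.Coprime ϑ.natAbs)), ∑ n₂ ∈ Icc 1 ⌊2 * N'⌋₊,
            (if ℓ₁ * n₁ = ℓ₂ * n₂ then
            (if (ℓ₂ * n₂).Coprime m ∧ ((ℓ₁ * n₁ : ℕ) : ZMod m) = ((ℓ₂ * n₂ : ℕ) : ZMod m) then
              (γ n₁ * ∑ a ∈ Icc 1 ⌊2 * A⌋₊, ν a * Complex.exp (2 * Real.pi * Complex.I *
                ((ϑ : ℂ) * (a : ℂ) * ((((m : ZMod (b * n₁))⁻¹).val : ℕ) : ℂ) / ((b * n₁ : ℕ) : ℂ) +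
                  (η : ℂ) * (a : ℂ) / ((m : ℂ) * ((b * n₁ : ℕ) : ℂ))))) *
              (starRingEnd ℂ) (γ n₂ * ∑ a ∈ Icc 1 ⌊2 * A⌋₊, ν a * Complex.exp (2 * Real.pi * Complex.I *
                ((ϑ : ℂ) * (a : ℂ) * ((((m : ZMod (b * n₂))⁻¹).val : ℕ) : ℂ) / ((b * n₂ : ℕ) : ℂ) +
                  (η : ℂ) * (a : ℂ) / ((m : ℂ) * ((b * n₂ : ℕ) : ℂ))))) else 0) else 0) =
      ∑ ℓ₁ ∈ ((Ioc L (2 * L)).filter (fun ℓ => ℓ.Prime ∧ ℓ.Coprime b ∧ ℓ.Coprime ϑ.natAbs)), ∑ n₁ ∈ Icc 1 ⌊2 * N'⌋₊, ∑ a₁ ∈ Icc 1 ⌊2 * A⌋₊,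
          ∑ ℓ₂ ∈ ((Ioc L (2 * L)).filter (fun ℓ => ℓ.Prime ∧ ℓ.Coprime b ∧ ℓ.Coprime ϑ.natAbs)), ∑ n₂ ∈ Icc 1 ⌊2 * N'⌋₊, ∑ a₂ ∈ Icc 1 ⌊2 * A⌋₊,
            (if ℓ₁ * n₁ = ℓ₂ * n₂ then
              (γ n₁ * ν a₁) * (starRingEnd ℂ) (γ n₂ * ν a₂) *
              ∑ m ∈ (Ioc ⌊M⌋₊ ⌊2 * M⌋₊).filter (fun m => m.Coprime b),
            (if (ℓ₂ * n₂).Coprime m then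
              Complex.exp (2 * Real.pi * Complex.I *
                ((ϑ : ℂ) * (a₁ : ℂ) * ((((m : ZMod (b * n₁))⁻¹).val : ℕ) : ℂ) / ((b * n₁ : ℕ) : ℂ) +
                  (η : ℂ) * (a₁ : ℂ) / ((m : ℂ) * ((b * n₁ : ℕ) : ℂ)))) *
              (starRingEnd ℂ) (Complex.exp (2 * Real.pi * Complex.I *
                ((ϑ : ℂ) * (a₂ : ℂ) * ((((m : ZMod (b * n₂))⁻¹).val : ℕ) : ℂ) / ((b * n₂ : ℕ) : ℂ) +
                  (η : ℂ) * (a₂ : ℂ) / ((m : ℂ) * ((b * n₂ : ℕ) : ℂ))))) else 0) else 0) := by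
  classical
  -- move the sum over `m` inside
  rw [Finset.sum_comm]
  refine Finset.sum_congr rfl fun ℓ₁ _ => ?_
  rw [Finset.sum_comm]
  refine Finset.sum_congr rfl fun n₁ _ => ?_
  -- for fixed `ℓ₁, n₁`: both sides as functions of the remaining variables
  have key : ∀ (ℓ₂ n₂ : ℕ), ∑ m ∈ (Ioc ⌊M⌋₊ ⌊2 * M⌋₊).filter (fun m => m.Coprime b),
      (if ℓ₁ * n₁ = ℓ₂ * n₂ then
            (if (ℓ₂ * n₂).Coprime m ∧ ((ℓ₁ * n₁ : ℕ) : ZMod m) = ((ℓ₂ * n₂ : ℕ) : ZMod m) then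
              (γ n₁ * ∑ a ∈ Icc 1 ⌊2 * A⌋₊, ν a * Complex.exp (2 * Real.pi * Complex.I *
                ((ϑ : ℂ) * (a : ℂ) * ((((m : ZMod (b * n₁))⁻¹).val : ℕ) : ℂ) / ((b * n₁ : ℕ) : ℂ) +
                  (η : ℂ) * (a : ℂ) / ((m : ℂ) * ((b * n₁ : ℕ) : ℂ))))) *
              (starRingEnd ℂ) (γ n₂ * ∑ a ∈ Icc 1 ⌊2 * A⌋₊, ν a * Complex.exp (2 * Real.pi * Complex.I *
                ((ϑ : ℂ) * (a : ℂ) * ((((m : ZMod (b * n₂))⁻¹).val : ℕ) : ℂ) / ((b * n₂ : ℕ) : ℂ) +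
                  (η : ℂ) * (a : ℂ) / ((m : ℂ) * ((b * n₂ : ℕ) : ℂ))))) else 0) else 0) =
      ∑ a₁ ∈ Icc 1 ⌊2 * A⌋₊, ∑ a₂ ∈ Icc 1 ⌊2 * A⌋₊,
        (if ℓ₁ * n₁ = ℓ₂ * n₂ then
              (γ n₁ * ν a₁) * (starRingEnd ℂ) (γ n₂ * ν a₂) *
              ∑ m ∈ (Ioc ⌊M⌋₊ ⌊2 * M⌋₊).filter (fun m => m.Coprime b),
            (if (ℓ₂ * n₂).Coprime m then
              Complex.exp (2 * Real.pi * Complex.I *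
                ((ϑ : ℂ) * (a₁ : ℂ) * ((((m : ZMod (b * n₁))⁻¹).val : ℕ) : ℂ) / ((b * n₁ : ℕ) : ℂ) +
                  (η : ℂ) * (a₁ : ℂ) / ((m : ℂ) * ((b * n₁ : ℕ) : ℂ)))) *
              (starRingEnd ℂ) (Complex.exp (2 * Real.pi * Complex.I *
                ((ϑ : ℂ) * (a₂ : ℂ) * ((((m : ZMod (b * n₂))⁻¹).val : ℕ) : ℂ) / ((b * n₂ : ℕ) : ℂ) +
                  (η : ℂ) * (a₂ : ℂ) / ((m : ℂ) * ((b * n₂ : ℕ) : ℂ))))) else 0) else 0) := by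
    intro ℓ₂ n₂
    by_cases hN : ℓ₁ * n₁ = ℓ₂ * n₂
    · simp only [if_pos hN]
      have hcast : ∀ m : ℕ, ((ℓ₁ * n₁ : ℕ) : ZMod m) = ((ℓ₂ * n₂ : ℕ) : ZMod m) := by
        intro m; rw [hN]
      simp only [hcast, and_true]
      -- expand the product of the two coefficients
      have hexp : ∀ m : ℕ,
          (γ n₁ * ∑ a ∈ Icc 1 ⌊2 * A⌋₊, ν a * Complex.exp (2 * Real.pi * Complex.I *
                ((ϑ : ℂ) * (a : ℂ) * ((((m : ZMod (b * n₁))⁻¹).val : ℕ) : ℂ) / ((b * n₁ : ℕ) : ℂ) +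
                  (η : ℂ) * (a : ℂ) / ((m : ℂ) * ((b * n₁ : ℕ) : ℂ))))) *
          (starRingEnd ℂ) (γ n₂ * ∑ a ∈ Icc 1 ⌊2 * A⌋₊, ν a * Complex.exp (2 * Real.pi * Complex.I *
                ((ϑ : ℂ) * (a : ℂ) * ((((m : ZMod (b * n₂))⁻¹).val : ℕ) : ℂ) / ((b * n₂ : ℕ) : ℂ) +
                  (η : ℂ) * (a : ℂ) / ((m : ℂ) * ((b * n₂ : ℕ) : ℂ))))) =
          ∑ a₁ ∈ Icc 1 ⌊2 * A⌋₊, ∑ a₂ ∈ Icc 1 ⌊2 * A⌋₊,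
            (γ n₁ * ν a₁) * (starRingEnd ℂ) (γ n₂ * ν a₂) *
              (Complex.exp (2 * Real.pi * Complex.I *
                ((ϑ : ℂ) * (a₁ : ℂ) * ((((m : ZMod (b * n₁))⁻¹).val : ℕ) : ℂ) / ((b * n₁ : ℕ) : ℂ) +
                  (η : ℂ) * (a₁ : ℂ) / ((m : ℂ) * ((b * n₁ : ℕ) : ℂ)))) * (starRingEnd ℂ) (Complex.exp (2 * Real.pi * Complex.I *
                ((ϑ : ℂ) * (a₂ : ℂ) * ((((m : ZMod (b * n₂))⁻¹).val : ℕ) : ℂ) / ((b * n₂ : ℕ) : ℂ) +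
                  (η : ℂ) * (a₂ : ℂ) / ((m : ℂ) * ((b * n₂ : ℕ) : ℂ)))))) := by
        intro m
        rw [map_mul, map_sum, Finset.mul_sum, Finset.mul_sum, Finset.sum_mul_sum]
        refine Finset.sum_congr rfl fun a₁ _ => Finset.sum_congr rfl fun a₂ _ => ?_
        rw [map_mul, map_mul]
        ring
      simp_rw [hexp]
      -- exchange `∑_m` with `∑_{a₁} ∑_{a₂}` and pull the `if` through
      rw [show (∑ m ∈ (Ioc ⌊M⌋₊ ⌊2 * M⌋₊).filter (fun m => m.Coprime b),
          if (ℓ₂ * n₂).Coprime m then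
            ∑ a₁ ∈ Icc 1 ⌊2 * A⌋₊, ∑ a₂ ∈ Icc 1 ⌊2 * A⌋₊,
              (γ n₁ * ν a₁) * (starRingEnd ℂ) (γ n₂ * ν a₂) *
                (Complex.exp (2 * Real.pi * Complex.I *
                ((ϑ : ℂ) * (a₁ : ℂ) * ((((m : ZMod (b * n₁))⁻¹).val : ℕ) : ℂ) / ((b * n₁ : ℕ) : ℂ) +
                  (η : ℂ) * (a₁ : ℂ) / ((m : ℂ) * ((b * n₁ : ℕ) : ℂ)))) * (starRingEnd ℂ) (Complex.exp (2 * Real.pi * Complex.I *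
                ((ϑ : ℂ) * (a₂ : ℂ) * ((((m : ZMod (b * n₂))⁻¹).val : ℕ) : ℂ) / ((b * n₂ : ℕ) : ℂ) +
                  (η : ℂ) * (a₂ : ℂ) / ((m : ℂ) * ((b * n₂ : ℕ) : ℂ))))))
          else 0) =
          ∑ m ∈ (Ioc ⌊M⌋₊ ⌊2 * M⌋₊).filter (fun m => m.Coprime b), ∑ a₁ ∈ Icc 1 ⌊2 * A⌋₊, ∑ a₂ ∈ Icc 1 ⌊2 * A⌋₊,
            (if (ℓ₂ * n₂).Coprime m then
              (γ n₁ * ν a₁) * (starRingEnd ℂ) (γ n₂ * ν a₂) *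
                (Complex.exp (2 * Real.pi * Complex.I *
                ((ϑ : ℂ) * (a₁ : ℂ) * ((((m : ZMod (b * n₁))⁻¹).val : ℕ) : ℂ) / ((b * n₁ : ℕ) : ℂ) +
                  (η : ℂ) * (a₁ : ℂ) / ((m : ℂ) * ((b * n₁ : ℕ) : ℂ)))) * (starRingEnd ℂ) (Complex.exp (2 * Real.pi * Complex.I *
                ((ϑ : ℂ) * (a₂ : ℂ) * ((((m : ZMod (b * n₂))⁻¹).val : ℕ) : ℂ) / ((b * n₂ : ℕ) : ℂ) +
                  (η : ℂ) * (a₂ : ℂ) / ((m : ℂ) * ((b * n₂ : ℕ) : ℂ))))))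
            else 0) from Finset.sum_congr rfl fun m _ => by
          split_ifs <;> simp]
      rw [Finset.sum_comm]
      refine Finset.sum_congr rfl fun a₁ _ => ?_
      rw [Finset.sum_comm]
      refine Finset.sum_congr rfl fun a₂ _ => ?_
      rw [Finset.mul_sum]
      refine Finset.sum_congr rfl fun m _ => ?_
      split_ifs <;> simp
    · simp only [if_neg hN, Finset.sum_const_zero]
  -- rewrite the left side with `key` and reorder `∑_{ℓ₂} ∑_{n₂} ∑_{a₁}` into `∑_{a₁} ∑_{ℓ₂} ∑_{n₂}`
  rw [Finset.sum_comm]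
  simp_rw [Finset.sum_comm (s := (Ioc ⌊M⌋₊ ⌊2 * M⌋₊).filter (fun m => m.Coprime b)) (t := Icc 1 ⌊2 * N'⌋₊), key]
  -- now `∑ ℓ₂, ∑ n₂, ∑ a₁, ∑ a₂`; bring `a₁` to the front
  conv_lhs => arg 2; ext ℓ₂; rw [Finset.sum_comm]
  rw [Finset.sum_comm]

/-- **Taking norms in the expanded diagonal**:
`‖∑_m Diag_m(c)‖ ≤ ∑_{ℓ₁,n₁,a₁} ∑_{ℓ₂,n₂,a₂} [ℓ₁n₁ = ℓ₂n₂] ‖γ_{n₁}‖‖ν_{a₁}‖ ‖γ_{n₂}‖‖ν_{a₂}‖ ‖S‖`.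
[cite: BettinChandee2018, §3] -/
theorem BC_diag_norm_le (b : ℕ) (M N' A : ℝ) (ϑ : ℤ) (η : ℝ) (γ ν : ℕ → ℂ) (L : ℕ) :
    ‖∑ m ∈ (Ioc ⌊M⌋₊ ⌊2 * M⌋₊).filter (fun m => m.Coprime b), ∑ ℓ₁ ∈ ((Ioc L (2 * L)).filter (fun ℓ => ℓ.Prime ∧ ℓ.Coprime b ∧ ℓ.Coprime ϑ.natAbs)), ∑ n₁ ∈ Icc 1 ⌊2 * N'⌋₊,
          ∑ ℓ₂ ∈ ((Ioc L (2 * L)).filter (fun ℓ => ℓ.Prime ∧ ℓ.Coprime b ∧ ℓ.Coprime ϑ.natAbs)), ∑ n₂ ∈ Icc 1 ⌊2 * N'⌋₊,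
            (if ℓ₁ * n₁ = ℓ₂ * n₂ then
            (if (ℓ₂ * n₂).Coprime m ∧ ((ℓ₁ * n₁ : ℕ) : ZMod m) = ((ℓ₂ * n₂ : ℕ) : ZMod m) then
              (γ n₁ * ∑ a ∈ Icc 1 ⌊2 * A⌋₊, ν a * Complex.exp (2 * Real.pi * Complex.I *
                ((ϑ : ℂ) * (a : ℂ) * ((((m : ZMod (b * n₁))⁻¹).val : ℕ) : ℂ) / ((b * n₁ : ℕ) : ℂ) +
                  (η : ℂ) * (a : ℂ) / ((m : ℂ) * ((b * n₁ : ℕ) : ℂ))))) *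
              (starRingEnd ℂ) (γ n₂ * ∑ a ∈ Icc 1 ⌊2 * A⌋₊, ν a * Complex.exp (2 * Real.pi * Complex.I *
                ((ϑ : ℂ) * (a : ℂ) * ((((m : ZMod (b * n₂))⁻¹).val : ℕ) : ℂ) / ((b * n₂ : ℕ) : ℂ) +
                  (η : ℂ) * (a : ℂ) / ((m : ℂ) * ((b * n₂ : ℕ) : ℂ))))) else 0) else 0)‖ ≤
      ∑ ℓ₁ ∈ ((Ioc L (2 * L)).filter (fun ℓ => ℓ.Prime ∧ ℓ.Coprime b ∧ ℓ.Coprime ϑ.natAbs)), ∑ n₁ ∈ Icc 1 ⌊2 * N'⌋₊, ∑ a₁ ∈ Icc 1 ⌊2 * A⌋₊,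
          ∑ ℓ₂ ∈ ((Ioc L (2 * L)).filter (fun ℓ => ℓ.Prime ∧ ℓ.Coprime b ∧ ℓ.Coprime ϑ.natAbs)), ∑ n₂ ∈ Icc 1 ⌊2 * N'⌋₊, ∑ a₂ ∈ Icc 1 ⌊2 * A⌋₊,
            (if ℓ₁ * n₁ = ℓ₂ * n₂ then
              (‖γ n₁‖ * ‖ν a₁‖) * (‖γ n₂‖ * ‖ν a₂‖) *
              ‖∑ m ∈ (Ioc ⌊M⌋₊ ⌊2 * M⌋₊).filter (fun m => m.Coprime b),
            (if (ℓ₂ * n₂).Coprime m then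
              Complex.exp (2 * Real.pi * Complex.I *
                ((ϑ : ℂ) * (a₁ : ℂ) * ((((m : ZMod (b * n₁))⁻¹).val : ℕ) : ℂ) / ((b * n₁ : ℕ) : ℂ) +
                  (η : ℂ) * (a₁ : ℂ) / ((m : ℂ) * ((b * n₁ : ℕ) : ℂ)))) *
              (starRingEnd ℂ) (Complex.exp (2 * Real.pi * Complex.I *
                ((ϑ : ℂ) * (a₂ : ℂ) * ((((m : ZMod (b * n₂))⁻¹).val : ℕ) : ℂ) / ((b * n₂ : ℕ) : ℂ) +
                  (η : ℂ) * (a₂ : ℂ) / ((m : ℂ) * ((b * n₂ : ℕ) : ℂ))))) else 0)‖ else 0) := by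
  classical
  rw [BC_diag_expand]
  refine (norm_sum_le _ _).trans (Finset.sum_le_sum fun ℓ₁ _ => ?_)
  refine (norm_sum_le _ _).trans (Finset.sum_le_sum fun n₁ _ => ?_)
  refine (norm_sum_le _ _).trans (Finset.sum_le_sum fun a₁ _ => ?_)
  refine (norm_sum_le _ _).trans (Finset.sum_le_sum fun ℓ₂ _ => ?_)
  refine (norm_sum_le _ _).trans (Finset.sum_le_sum fun n₂ _ => ?_)
  refine (norm_sum_le _ _).trans (Finset.sum_le_sum fun a₂ _ => ?_)
  split_ifs with hN
  · rw [norm_mul, norm_mul, norm_mul, Complex.norm_conj, norm_mul]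
  · simp

end Literature.NumberTheory.LFunctions

end
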